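import Mathlib
import HarnessLib
import Literature.NumberTheory.LFunctions.SuzukiCanonicalSystem
import Summits.RiemannHypothesis.RiemannHypothesis.Theorems.SuzukiWindowsDoorOpPath
import Summits.RiemannHypothesis.RiemannHypothesis.Theorems.SuzukiWindowsDoorPlumbing
import Summits.RiemannHypothesis.RiemannHypothesis.Theorems.DeBrangesSuzukiDoorShiftWitness
import Summits.RiemannHypothesis.RiemannHypothesis.Theorems.DeBrangesSuzukiDoorTailWitnessIndex
import Summits.RiemannHypothesis.RiemannHypothesis.Theorems.DeBrangesSuzukiDoorTailWitnessCells

/-!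
# RiemannHypothesis / de Branges–Suzuki door — tail witness, file 4/4: L1 `TailGivesShiftWitness` PROVED and
the window TAIL of Suzuki's criterion is RH-EQUIVALENT for every cut (cell rh-split T12 / Q2)

* `tailGivesShiftWitness` (RH-FREE, ζ-FREE, K-general): for every continuous `K` and real `H`, if `±1` is never an
  eigenvalue of `𝖪[t]` for `t > H` (`NoUnitEigenvalue K t`), then some `c ≠ 0` has
  `u ↦ ∫_0^1 Σ_{j<N} c_j K(u + y − j) dy ∈ L²(ℝ)` — VERBATIM the hypothesis `hL1` of the landed
  `SuzukiDoorShiftWitness.tailWindows_iff_rh_of_generalStep` (p467879).  Proof: the eventual index bound (file 2/4)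
  for the operator path `SuzukiWindowsDoorOpPath.op` (no `±1`-eigenvectors for `t > max H 0` by `stub_eigenTransfer`),
  applied to the `(M+1)`-dimensional cell space (file 3/4); unit coefficient vectors with windows bounded by `N²`;
  compactness of the unit sphere of `Fin N → ℝ`; continuity of `c ↦ ∫_{−m}^{m} W_c²`;
  `integrable_of_intervalIntegral_norm_bounded`.
* `tailWindows_iff_rh` (RH-EQUIVALENCE, unconditional): ∀ θ > 10, ∀ H, «no unit eigenvalue of `𝖪_θ[t]` for `t > H`»
  ⟺ RH; `rh_of_tailWindows`; `and_tailWindows_imp_rh` (any FIN conjunct is decoration); `eventuallyClean_iff_rh`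
  (the window ∃-tail is RH).
Cell reading: census row C3 of `cards/SPLIT-dbr-neg.md` becomes DEGENERATE by theorem (was «modulo L1»); Q2 = T12
ANSWERED in kernel.  Zero definitions.  Filed by rh-split-typer-2 g2 (--supports stmt-RiemannHypothesis-19728).
SPLITTING SEARCH bookkeeping over an RH-EQUIVALENT criterion; nothing here bears on the truth of RH.
-/

set_option linter.dupNamespace false

noncomputable section

namespace Summit.RiemannHypothesis.RiemannHypothesis.Theorems.SuzukiDoorTailWitness

open MeasureTheory Set Filter Topology Module
open Literature.NumberTheory.LFunctions
open Summit.RiemannHypothesis.RiemannHypothesis.Theorems.SuzukiWindowsDoorOpPath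
open Summit.RiemannHypothesis.RiemannHypothesis.Cruxes.WindowsImplyContraction.Plumbing

variable {K : ℝ → ℝ}

/-! ## 11. Assembly: the tail gives a shift witness (L1, K-general, ζ-free) -/

/-- **L1 `TailGivesShiftWitness` (K-general, ζ-free), the spectral step of cell rh-split's T12, PROVED.**
For every continuous real kernel `K` and every real `H`: if `±1` is never an eigenvalue of the truncated Hankel
operator `𝖪[t] : f ↦ 1_{(−t,t)} ∫_{(−t,t)} K(·+y) f(y) dy` for `t > H` (`NoUnitEigenvalue K t`), then some non-trivial
integer-grid step input `g_c = Σ_{j<N} c_j 1_{(−j,1−j)}` has `𝖪 g_c ∈ L²(ℝ)`, i.e.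
`u ↦ ∫_0^1 Σ_j c_j K(u + y − j) dy` is square-integrable.  This is EXACTLY the hypothesis `hL1` of the landed
`Theorems.SuzukiDoorShiftWitness.tailWindows_iff_rh_of_generalStep` (p467879).  Proof: `eventual_index_bound` on
the tree's operator path `SuzukiWindowsDoorOpPath.op` (+ `stub_eigenTransfer`), the `(M+1)`-dimensional cell space,
compactness of its unit sphere, continuity of `c ↦ ∫_{−m}^{m} W_c²`, and `integrable_of_intervalIntegral_norm_bounded`. -/
theorem tailGivesShiftWitness :
    ∀ K : ℝ → ℝ, Continuous K → ∀ H : ℝ, (∀ t : ℝ, H < t → NoUnitEigenvalue K t) →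
      ∃ (N : ℕ) (c : Fin N → ℝ), c ≠ 0 ∧ MemLp (fun u : ℝ => ∫ y in Ioo (0 : ℝ) 1,
        ∑ j : Fin N, c j * K (u + y - ((j : ℕ) : ℝ))) 2 volume := by
  intro K hK H hT
  -- Step 0: reduce to `H' = max H 0 ≥ 0`
  set H' : ℝ := max H 0 with hH'
  have hH'0 : 0 ≤ H' := le_max_right _ _
  -- Step 1: the abstract eventual index bound for the operator path `t ↦ 𝖪[t]`
  have hno : ∀ t : ℝ, H' < t → ∀ v : Lp ℝ 2 (volume : Measure ℝ),
      (op hK t v = v ∨ op hK t v = -v) → v = 0 := fun t ht v hv =>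
    stub_eigenTransfer K hK (op hK) (fun s _ f => op_repr hK s f) t (hH'0.trans ht.le)
      (hT t (lt_of_le_of_lt (le_max_left _ _) ht)) v hv
  obtain ⟨M, hM⟩ := eventual_index_bound (op hK) (continuous_op hK) (fun t _ => isSelfAdjoint_op hK t)
    (fun t _ => isCompactOperator_op hK t) hH'0 hno
  -- Step 2: the cell space of dimension `N = M + 1`
  set N : ℕ := M + 1 with hN
  set Φ : (Fin N → ℝ) →ₗ[ℝ] Lp ℝ 2 (volume : Measure ℝ) := Fintype.linearCombination ℝ (fun j : Fin N =>
    (indicatorConstLp 2 (measurableSet_Ioo (a := -((j : ℕ) : ℝ)) (b := 1 - ((j : ℕ) : ℝ)))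
      (volume_cell_ne_top j) (1 : ℝ) : Lp ℝ 2 (volume : Measure ℝ))) with hΦ
  have hinj : Function.Injective Φ := cellComb_injective N
  have hrank : finrank ℝ (LinearMap.range Φ) = N := by
    rw [LinearMap.finrank_range_of_inj hinj, Module.finrank_fin_fun]
  -- Step 3: for every `k`, a unit coefficient vector whose windows up to `k` are bounded by `N²`
  have step : ∀ k : ℕ, ∃ c : Fin N → ℝ, ‖c‖ = 1 ∧ ∀ m : ℕ, m ≤ k →
      ∫ u in (-(m : ℝ))..m, (∫ y in (0 : ℝ)..1, ∑ j : Fin N, c j * K (u + y - ((j : ℕ) : ℝ))) ^ 2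
        ≤ (N : ℝ) ^ 2 := by
    intro k
    set n : ℕ := k + N + ⌈H'⌉₊ + 1 with hn
    have hn1 : H' < n := by
      have h1 : H' ≤ ⌈H'⌉₊ := Nat.le_ceil H'
      have h2 : ((k + N + ⌈H'⌉₊ + 1 : ℕ) : ℝ) = k + N + ⌈H'⌉₊ + 1 := by push_cast; ring
      rw [hn, h2]
      have : (0 : ℝ) ≤ k := Nat.cast_nonneg k
      have : (0 : ℝ) ≤ N := Nat.cast_nonneg N
      linarith
    have hNn : N ≤ n := by rw [hn]; omega
    obtain ⟨g, hg, hg0, hle⟩ := hM n hn1 (LinearMap.range Φ) inferInstance (by rw [hrank, hN]; omega)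
    obtain ⟨c, rfl⟩ := LinearMap.mem_range.1 hg
    have hc0 : c ≠ 0 := fun h => hg0 (by rw [h, map_zero])
    have hcn : 0 < ‖c‖ := norm_pos_iff.2 hc0
    refine ⟨‖c‖⁻¹ • c, norm_smul_inv_norm hc0, fun m hm => ?_⟩
    have hle' : ‖op hK n (Φ (‖c‖⁻¹ • c))‖ ≤ ‖Φ (‖c‖⁻¹ • c)‖ := by
      rw [map_smul, map_smul, norm_smul, norm_smul]
      exact mul_le_mul_of_nonneg_left hle (norm_nonneg _)
    have hnorm1 : ‖‖c‖⁻¹ • c‖ ≤ 1 := (norm_smul_inv_norm hc0).le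
    have hmn : m + 1 ≤ n := by rw [hn]; omega
    calc ∫ u in (-(m : ℝ))..m, (∫ y in (0 : ℝ)..1, ∑ j : Fin N, (‖c‖⁻¹ • c) j * K (u + y - ((j : ℕ) : ℝ))) ^ 2
        ≤ ∫ x in Ioo (-(n : ℝ)) n, (∫ y in (0 : ℝ)..1, ∑ j : Fin N, (‖c‖⁻¹ • c) j * K (x + y - ((j : ℕ) : ℝ))) ^ 2 :=
          intervalIntegral_sq_le_window hK _ hmn
      _ = ‖op hK n (Φ (‖c‖⁻¹ • c))‖ ^ 2 := by rw [hΦ, norm_sq_op_cellComb hK hNn]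
      _ ≤ ‖Φ (‖c‖⁻¹ • c)‖ ^ 2 := pow_le_pow_left₀ (norm_nonneg _) hle' 2
      _ ≤ (N : ℝ) ^ 2 := by
          refine pow_le_pow_left₀ (norm_nonneg _) ?_ 2
          rw [hΦ]
          exact norm_cellComb_le _ hnorm1
  choose cseq hnorm hbound using step
  -- Step 4: compactness of the unit sphere of `Fin N → ℝ`
  have hsph : ∀ k, cseq k ∈ Metric.sphere (0 : Fin N → ℝ) 1 := fun k =>
    mem_sphere_zero_iff_norm.2 (hnorm k)
  obtain ⟨cinf, hcinf, φ, hφ, hlim⟩ := (isCompact_sphere (0 : Fin N → ℝ) 1).tendsto_subseq hsph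
  have hcinf1 : ‖cinf‖ = 1 := mem_sphere_zero_iff_norm.1 hcinf
  have hcinf0 : cinf ≠ 0 := by
    intro h; rw [h, norm_zero] at hcinf1; exact zero_ne_one hcinf1
  -- Step 5: the window bounds pass to the limit
  have hlimbound : ∀ m : ℕ,
      ∫ u in (-(m : ℝ))..m, (∫ y in (0 : ℝ)..1, ∑ j : Fin N, cinf j * K (u + y - ((j : ℕ) : ℝ))) ^ 2
        ≤ (N : ℝ) ^ 2 := by
    intro m
    have hcont := continuous_sqInt hK N (m : ℝ)
    have ht := (hcont.tendsto cinf).comp hlim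
    refine le_of_tendsto ht ?_
    refine Filter.eventually_atTop.2 ⟨m, fun k hk => ?_⟩
    have hmk : m ≤ φ k := hk.trans (hφ.id_le k)
    exact hbound (φ k) m hmk
  -- Step 6: square-integrability on the line
  have hWc : Continuous fun u : ℝ =>
      ∫ y in (0 : ℝ)..1, ∑ j : Fin N, cinf j * K (u + y - ((j : ℕ) : ℝ)) :=
    continuous_shiftWindow_right hK cinf
  have hint : Integrable (fun u : ℝ =>
      (∫ y in (0 : ℝ)..1, ∑ j : Fin N, cinf j * K (u + y - ((j : ℕ) : ℝ))) ^ 2) volume := by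
    refine integrable_of_intervalIntegral_norm_bounded ((N : ℝ) ^ 2) (l := Filter.atTop)
      (a := fun i : ℕ => -(i : ℝ)) (b := fun i : ℕ => (i : ℝ)) ?_ ?_ ?_ ?_
    · intro i
      exact ((hWc.pow 2).continuousOn.integrableOn_Icc).mono_set Ioc_subset_Icc_self
    · exact tendsto_neg_atTop_atBot.comp tendsto_natCast_atTop_atTop
    · exact tendsto_natCast_atTop_atTop
    · refine Filter.Eventually.of_forall fun i => ?_
      have := hlimbound i
      refine le_trans (le_of_eq ?_) this
      refine intervalIntegral.integral_congr fun u _ => ?_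
      simp only [Real.norm_eq_abs, abs_pow, sq_abs]
  have hmem : MemLp (fun u : ℝ =>
      ∫ y in (0 : ℝ)..1, ∑ j : Fin N, cinf j * K (u + y - ((j : ℕ) : ℝ))) 2 volume :=
    (memLp_two_iff_integrable_sq hWc.aestronglyMeasurable).2 hint
  -- Step 7: the `Ioo`-spelling of the witness
  refine ⟨N, cinf, hcinf0, ?_⟩
  have heq : (fun u : ℝ => ∫ y in Ioo (0 : ℝ) 1, ∑ j : Fin N, cinf j * K (u + y - ((j : ℕ) : ℝ))) =
      fun u : ℝ => ∫ y in (0 : ℝ)..1, ∑ j : Fin N, cinf j * K (u + y - ((j : ℕ) : ℝ)) := by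
    funext u
    rw [intervalIntegral.integral_of_le zero_le_one, integral_Ioc_eq_integral_Ioo]
  rw [heq]
  exact hmem

/-! ## 12. Consequence for ζ: the window TAIL is RH-equivalent for every cut `H` (T12 / Q2 of cell rh-split) -/

/-- **Tail-rigidity of Suzuki's window criterion, UNCONDITIONAL.** For every `θ > 10` and every real `H`:
«no eigenvalue `±1` of `𝖪_θ[t]` for `t > H`» ⟺ `RiemannHypothesis` — the landed
`SuzukiDoorShiftWitness.tailWindows_iff_rh_of_generalStep` (p467879) with its K-general spectral hypothesis
discharged by `tailGivesShiftWitness`.  (RH-EQUIVALENCE; nothing here bears on the truth of RH.) -/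
theorem tailWindows_iff_rh {θ : ℝ} (hθ : 10 < θ) (H : ℝ) :
    (∀ t : ℝ, H < t → NoUnitEigenvalue (Literature.NumberTheory.LFunctions.limKernel θ) t) ↔
      _root_.RiemannHypothesis :=
  SuzukiDoorShiftWitness.tailWindows_iff_rh_of_generalStep tailGivesShiftWitness hθ H

/-- The RH-free direction by name: a clean window tail beyond ANY height forces RH. -/
theorem rh_of_tailWindows {θ : ℝ} (hθ : 10 < θ) (H : ℝ)
    (h : ∀ t : ℝ, H < t → NoUnitEigenvalue (Literature.NumberTheory.LFunctions.limKernel θ) t) :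
    _root_.RiemannHypothesis :=
  (tailWindows_iff_rh hθ H).1 h

/-- Splitting-matrix reading (cell rh-split, dbr × neg, census C3): in `FIN_dbr(θ,H) ∧ TAIL_dbr(θ,H) ⟹ RH` the finite
conjunct is DECORATION for every `H` — `A ∧ TAIL(H) → RH` for an arbitrary proposition `A`. -/
theorem and_tailWindows_imp_rh {θ : ℝ} (hθ : 10 < θ) (H : ℝ) (A : Prop) :
    A ∧ (∀ t : ℝ, H < t → NoUnitEigenvalue (Literature.NumberTheory.LFunctions.limKernel θ) t) →
      _root_.RiemannHypothesis :=
  fun h => rh_of_tailWindows hθ H h.2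

/-- **The window ∃-tail is RH** (cell rh-split ∃-tail catalogue, dbr row: `EventuallyClean θ ⟺ RH`): for `θ > 10`,
«for some `H`, no unit eigenvalue of `𝖪_θ[t]` beyond `H`» ⟺ `RiemannHypothesis`. -/
theorem eventuallyClean_iff_rh {θ : ℝ} (hθ : 10 < θ) :
    (∃ H : ℝ, ∀ t : ℝ, H < t → NoUnitEigenvalue (Literature.NumberTheory.LFunctions.limKernel θ) t) ↔
      _root_.RiemannHypothesis :=
  ⟨fun ⟨H, h⟩ => rh_of_tailWindows hθ H h, fun h => ⟨0, (tailWindows_iff_rh hθ 0).2 h⟩⟩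

end Summit.RiemannHypothesis.RiemannHypothesis.Theorems.SuzukiDoorTailWitness

end
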